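import Summits.SmoothPoincare4.SmoothPoincare4.Theorems.ConvexBisectionAcyclicBisectionExistsEulerCounts
import Summits.SmoothPoincare4.SmoothPoincare4.Theorems.ConvexBisectionAcyclicBisectionExistsEulerHandleModels
import Summits.SmoothPoincare4.SmoothPoincare4.Theorems.ConvexBisectionAcyclicBisectionExistsEulerHandles
import HarnessLib

/-!
# Assembly: `χ(V ∪ n H²) = χ(V) + n` unconditionally, and `l.length = 4 * g` from the Betti numbers of the base
(sub-goal `stub_modelsOn_counts_length_of_betti_numbers` of stub `stub_modelsOn_counts`, line `modp-braid-orbits`,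
reshape r9, crux `ConvexBisection.AcyclicBisectionExists`, item stmt-SmoothPoincare4-10508)

Plugs the four model Euler characteristics of `…EulerHandleModels.lean` (`stub_modelsOn_counts_eulerHandleModels`,
at `m = 2`) into the inclusion–exclusion of `…EulerHandles.lean` (`stub_modelsOn_counts_eulerHandles`), giving the
unconditional count `χ(X) = χ(V) + n` for a Kosinski multi-attachment of `n` 2-handles on a compact smooth
4-manifold with boundary (`relEuler_of_isMultiAttachment_four`), and discharges with it the hypothesis `hχ` of
`stub_modelsOn_counts_length_of_betti` (`…EulerCounts.lean`): the first clause `l.length = 4 * g` of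
`LefschetzBase.modelsOn_counts_of_homotopyEquiv_sphere` (Gompf–Stipsicz 1999, §8.2) now depends only on the
rational Betti numbers of the concrete base `Base g` (`b₀ = 1`, `b₁ = 2g`, `bₖ = 0` for `k ≥ 2`; Milnor 1968,
Thm. 9.1 — proved from the Milnor cover in `Literature/Topology/FourManifolds/LefschetzBaseBetti.lean`,
`LefschetzBase.bettiNumbers_base`; the unconditional count is assembled in the sibling `…CountsLength.lean`).
No definitions, no named facts, no `sorry`.
-/

noncomputable section

-- the prescribed namespace `Summit.<P>.<Sub>.…` duplicates `SmoothPoincare4` (P = Sub)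
set_option linter.dupNamespace false

open scoped Manifold ContDiff Topology ContinuousMap
open Set Function CategoryTheory CategoryTheory.Limits
open Literature.AlgebraicTopology.SingularHomology Literature.Topology.FourManifolds
  Literature.Topology.FourManifolds.LefschetzBase

namespace Summit.SmoothPoincare4.SmoothPoincare4.Theorems.AcyclicBisectionExists.ModpBraidOrbits

/-- **`χ(X) = χ(V) + n` for a Kosinski multi-attachment `X` of `n` 2-handles on a compact smooth 4-manifold with
boundary `V`** (Kosinski 1993, VI §6 / Kirby 1989, I §1), unconditionally, with the finiteness of `H_•(X; ℤ)`.
[folklore] -/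
theorem relEuler_of_isMultiAttachment_four {V : Type} [TopologicalSpace V] [T2Space V] [CompactSpace V]
    [ChartedSpace (EuclideanHalfSpace 4) V] [IsManifold (𝓡∂ 4) ∞ V] {n : ℕ}
    (h : Fin n → HandleAttachingMap 3 2 V) (X : Type) [TopologicalSpace X] [ChartedSpace (EuclideanHalfSpace 4) X]
    (hX : HandleAttachingMap.IsMultiAttachment h (𝓡∂ 4) X) :
    FinRelHomology ℤ ℤ X ∅ (2 * n + 9) ∧ relEuler ℤ ℤ X ∅ = relEuler ℤ ℤ V ∅ + n :=
  have hM := stub_modelsOn_counts_eulerHandleModels 2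
  stub_modelsOn_counts_eulerHandles hM.1 hM.2.1 hM.2.2.1 hM.2.2.2 V n h X hX

/-- **Sub-goal `stub_modelsOn_counts_length_of_betti_numbers` of stub `stub_modelsOn_counts`**: the first clause
`l.length = 4 * g` of `LefschetzBase.modelsOn_counts_of_homotopyEquiv_sphere` (Gompf–Stipsicz 1999, §8.2) for a
one-sided Lefschetz model `ModelsOn M g l` of a homotopy 4-sphere `M`, from the rational Betti numbers of the base
alone (`b₀ = 1`, `b₁ = 2g`, `bₖ = 0` for `k ≥ 2`; Milnor 1968 Thm. 9.1): `2 = χ(M) = χ(X) + χ(Base g) - χ(∂X)`,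
`χ(X) = χ(Base g) + l.length`, `χ(Base g) = 1 - 2g`, `χ(∂X) = 0`. [folklore] -/
theorem stub_modelsOn_counts_length_of_betti_numbers :
    (∀ g : ℕ, bettiNumber ℚ (Base g) 0 = 1 ∧ bettiNumber ℚ (Base g) 1 = 2 * g ∧
      ∀ k, 2 ≤ k → bettiNumber ℚ (Base g) k = 0) →
    ∀ (M : Type) [TopologicalSpace M] [T2Space M] [SecondCountableTopology M]
      [ChartedSpace (EuclideanSpace ℝ (Fin 4)) M] [IsManifold (𝓡 4) ∞ M] (g : ℕ)
      (l : List ((Fin g ⊕ Fin g → ℤ) × Bool)),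
      M ≃ₕ Metric.sphere (0 : EuclideanSpace ℝ (Fin 5)) 1 → ModelsOn M g l → l.length = 4 * g :=
  stub_modelsOn_counts_length_of_betti fun g _ h X _ _ _ _ _ _ hX =>
    (relEuler_of_isMultiAttachment_four (V := Base g) h X hX).2

end Summit.SmoothPoincare4.SmoothPoincare4.Theorems.AcyclicBisectionExists.ModpBraidOrbits

end
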